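import Summits.ResolutionOfSingularities.ResolutionOfSingularities.Theorems.HomologicalConductorNoZenoSubdivisionNodeBlowup
import Literature.AlgebraicGeometry.Resolution.RegularBlowup
import Literature.AlgebraicGeometry.Resolution.BlowupsProperProofs
import Literature.AlgebraicGeometry.Resolution.BlowupsIntegral
import Literature.AlgebraicGeometry.Resolution.BlowupExceptionalFibreIrreducible
import Literature.AlgebraicGeometry.Resolution.BlowupExceptionalFibreNontrivial
import Literature.AlgebraicGeometry.Resolution.HilbertSamuelIsolatedSingularities
import Literature.AlgebraicGeometry.Resolution.SubschemeRegularStalks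
import Literature.AlgebraicGeometry.Resolution.ComponentGluing
import HarnessLib

/-!
# Crux `NoZenoR` (stmt-ResolutionOfSingularities-19943), slot `stub_L1wCoreF`, (B1) — (1δ) «`X¹` is a resolution» and the node
# curves of the blow-up of the node set

Route `ResolutionOfSingularities/HomologicalConductor`, crux chain W4.4.  OURS (cell res-hironaka; planner res-L0-w44-plan-1 DESK WORD 18
«o5 → (1δ) + hnode in ONE file `…NodeBlowupResolution.lean`»); AI-written, weaker than expert review; nothing of the manuscript under review
(Hironaka 2017) is used and no Theses declaration is asserted.  Def-free, `--supports 19943 --as helper`.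

Setting: `π : X → Spec S` a RESOLUTION of the Noetherian local domain `S` of Krull dimension `2`, with finitely many integral exceptional
curves; `ρ : X¹ → X` a blow-up of the vanishing ideal of `closure (sepNodes π)` (the literal clause of `IsSepX1Sandwiched`).  By
`closure_sepNodes_eq` (p565476) the centre is the FINITE SET OF CLOSED NODES, so:

* (1δ) `isRegular_subscheme_vanishingIdeal_of_finite` (a finite set of closed points with its reduced structure is a regular closed
  subscheme: quotient stalks are residue FIELDS, tree `stalkIdeal_vanishingIdeal_of_finite`), `isRegular_centre`; **`isRegular`** (`X¹` is
  regular — tree `IsBlowup.isRegular_of_isRegular_subscheme`, Liu 8.1.19 (a)); **`isProper`** (tree `IsBlowup.isProper`, GW 13.96);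
  `sepNodes_ne_univ` / `vanishingIdeal_sepNodes_ne_bot`; **`isIntegral`**, **`isBirational`** (tree `IsBlowup.isIntegral` /
  `isBirational'`, Stacks 02ND); **`isResolution_comp : IsResolution (ρ ≫ π)`** (birational ∘ birational: tree `IsBirational.comp`).
* (hnode) `stalkIdeal_centre_eq_maximalIdeal`, `maximalIdeal_stalk_ne_bot_of_mem_sepNodes`, `isIrreducible_fibre` (the fibre over a node
  is IRREDUCIBLE — tree `IsBlowup.isIrreducible_preimage_singleton`, Hartshorne II 8.24 (b)), and
  **`hnode_of_fibre_nontrivial`**: `∀ z ∈ sepNodes π, ∃ n ∈ excCurvePoints (ρ ≫ π), ρ⁻¹{z} = closure {n}` — the residual input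
  `hnode` of `NodeBlowup.subdivision_nodeBlowup` (p566533) — GIVEN ONLY that each fibre `ρ⁻¹{z}` has at least two points
  (`hpos : (ρ ⁻¹' {z}).Nontrivial`; «the exceptional fibre over a regular surface point is a CURVE `ℙ¹_{κ(z)}`, not a point» —
  the one fact of the exceptional-divisor geometry not yet by name in the tree, kept BY SIGNATURE);
  **`subdivision_nodeBlowup_of_fibre_nontrivial`** — the subdivision clause for the node blow-up with `hnode` so discharged;
  v2: `two_le_ringKrullDim_stalk_of_mem_sepNodes`, **`fibre_nontrivial`** (`hpos` DISCHARGED by the tree's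
  `IsBlowup.nontrivial_preimage_singleton`, `Literature/…/BlowupExceptionalFibreNontrivial`), **`hnode`** and
  **`subdivision_nodeBlowup_of_isAcyclic`** — unconditional on blow-up geometry.

References: Q. Liu, *Algebraic Geometry and Arithmetic Curves* (2002), Thm. 8.1.19 [`Liu2002`]; U. Görtz–T. Wedhorn, *Algebraic
Geometry I* (2020), Prop. 13.91, 13.96 [`GortzWedhorn2020`]; The Stacks Project, Tags 02ND, 02OS [`StacksProject`]; R. Hartshorne,
*Algebraic Geometry* (1977), II Thm. 8.24 (b) [`Hartshorne1977`].
-/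

noncomputable section

-- single-problem summit: the doubled namespace component `ResolutionOfSingularities` is forced
set_option linter.dupNamespace false

namespace Summit.ResolutionOfSingularities.ResolutionOfSingularities.Theorems.NoZeno.ExcCount.NodeBlowup

open CategoryTheory AlgebraicGeometry TopologicalSpace Topology IsLocalRing
open Literature.AlgebraicGeometry.Resolution Scheme.IdealSheafData

/-! ## A finite set of closed points is a regular centre -/

/-- **A finite set of closed points, with its reduced structure, is a regular closed subscheme** of a locally Noetherian scheme:
at each of its points the stalk of its ideal is `𝔪_x` (tree `stalkIdeal_vanishingIdeal_of_finite`), so the quotient stalk is the residue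
FIELD. [folklore] -/
theorem isRegular_subscheme_vanishingIdeal_of_finite {X : Scheme.{0}} [IsLocallyNoetherian X] {Z : Closeds X}
    (hfin : (Z : Set X).Finite) (hcl : ∀ x ∈ (Z : Set X), IsClosed ({x} : Set X)) :
    Scheme.IsRegular (vanishingIdeal Z).subscheme := by
  refine Scheme.isRegular_subscheme_of_forall _ fun y hy => ?_
  rw [← SetLike.mem_coe, coe_support_vanishingIdeal] at hy
  rw [stalkIdeal_vanishingIdeal_of_finite hfin hcl hy]
  letI := Ideal.Quotient.field (maximalIdeal (X.presheaf.stalk y))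
  infer_instance

variable {S : Type} [CommRing S] [IsLocalRing S] [IsNoetherianRing S] {X X1 : Scheme.{0}}
  (π : X ⟶ Spec (.of S)) [IsProper π] (ρ : X1 ⟶ X) (hfin : (excCurvePoints π).Finite)

include hfin in
/-- The centre `closure (sepNodes π)`, as a set, is the finite node set. [this work] -/
theorem coe_centre_eq : ((⟨closure (sepNodes π), isClosed_closure⟩ : Closeds X) : Set X) = sepNodes π :=
  closure_sepNodes_eq π hfin

include hfin in
/-- **(1δ-a) The centre of the node blow-up is a regular closed subscheme** (finitely many closed points). [this work] -/
theorem isRegular_centre : Scheme.IsRegular (vanishingIdeal (⟨closure (sepNodes π), isClosed_closure⟩ : Closeds X)).subscheme := by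
  haveI : IsLocallyNoetherian X := LocallyOfFiniteType.isLocallyNoetherian π
  refine isRegular_subscheme_vanishingIdeal_of_finite ?_ ?_
  · rw [coe_centre_eq π hfin]; exact sepNodes_finite π hfin
  · intro x hx
    rw [coe_centre_eq π hfin] at hx
    exact isClosed_singleton_of_mem_sepNodes π hx

include hfin in
/-- **(1δ-b) `X¹` is REGULAR**: the blow-up of a regular locally Noetherian scheme along a regular centre is regular (Liu 8.1.19 (a), tree
`IsBlowup.isRegular_of_isRegular_subscheme`). [cite: Liu2002, Thm. 8.1.19 (a)] -/
theorem isRegular (hX : Scheme.IsRegular X) (hρ : IsBlowup ρ (vanishingIdeal ⟨closure (sepNodes π), isClosed_closure⟩)) :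
    Scheme.IsRegular X1 := by
  haveI : IsLocallyNoetherian X := LocallyOfFiniteType.isLocallyNoetherian π
  exact hρ.isRegular_of_isRegular_subscheme hX (isRegular_centre π hfin)

/-- **(1δ-c) `ρ` is PROPER** (blow-ups of locally Noetherian schemes are projective, GW 13.96 (1); tree `IsBlowup.isProper`).
[cite: GortzWedhorn2020, Prop. 13.96 (1)] -/
theorem isProper (hρ : IsBlowup ρ (vanishingIdeal ⟨closure (sepNodes π), isClosed_closure⟩)) : IsProper ρ := by
  haveI : IsLocallyNoetherian X := LocallyOfFiniteType.isLocallyNoetherian π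
  exact hρ.isProper

omit [IsNoetherianRing S] [IsProper π] in
/-- **The node set is not all of `X`** (for `X` non-empty): a node `z` is a proper specialisation of an exceptional curve `η`, and `η`
(height `1`) is not a node (nodes have height `0`). [this work] -/
theorem sepNodes_ne_univ [Nonempty X] : sepNodes π ≠ Set.univ := by
  intro h
  obtain ⟨x⟩ := ‹Nonempty X›
  have hx : x ∈ sepNodes π := h ▸ Set.mem_univ x
  -- a curve `η` through the node `x`
  obtain ⟨η, hη⟩ : ∃ η : X, η ∈ excCurvePoints π := by
    obtain ⟨-, hx'⟩ := (mem_sepNodes_iff π x).mp hx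
    rcases hx' with ⟨⟨η, V⟩, -, -, ⟨hη, -⟩, -⟩ | ⟨η, -, -, -, hη, -⟩
    · exact ⟨η, hη⟩
    · exact ⟨η, hη⟩
  have hη0 := height_eq_zero_of_mem_sepNodes π (h ▸ Set.mem_univ η)
  rw [hη.2] at hη0
  exact one_ne_zero hη0

include hfin in
/-- The vanishing ideal of the node set is non-zero (`X` non-empty). [this work] -/
theorem vanishingIdeal_centre_ne_bot [Nonempty X] :
    vanishingIdeal (⟨closure (sepNodes π), isClosed_closure⟩ : Closeds X) ≠ ⊥ := by
  intro h
  apply sepNodes_ne_univ π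
  rw [← coe_centre_eq π hfin, ← coe_support_vanishingIdeal (⟨closure (sepNodes π), isClosed_closure⟩ : Closeds X), h,
    support_bot]
  rfl

include hfin in
/-- **(1δ-d) `X¹` is INTEGRAL** (blow-up of an integral scheme along a non-zero ideal, Stacks 02ND; tree `IsBlowup.isIntegral`).
[cite: StacksProject, Tag 02ND] -/
theorem isIntegral [IsIntegral X] (hρ : IsBlowup ρ (vanishingIdeal ⟨closure (sepNodes π), isClosed_closure⟩)) : IsIntegral X1 :=
  hρ.isIntegral (vanishingIdeal_centre_ne_bot π hfin)

include hfin in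
/-- **(1δ-e) `ρ` is BIRATIONAL** (tree `IsBlowup.isBirational'`, Stacks 02ND + 02OS). [cite: StacksProject, Tag 02OS] -/
theorem isBirational [IsIntegral X] (hρ : IsBlowup ρ (vanishingIdeal ⟨closure (sepNodes π), isClosed_closure⟩)) : IsBirational ρ :=
  hρ.isBirational' (vanishingIdeal_centre_ne_bot π hfin)

include hfin in
/-- **(1δ) `X¹ → Spec S` IS A RESOLUTION**: for a resolution `π : X → Spec S` (`S` Noetherian local) with finitely many exceptional curves
and a blow-up `ρ : X¹ → X` of (the vanishing ideal of the closure of) the node set, `ρ ≫ π` is proper (proper ∘ proper), birational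
(birational ∘ birational, tree `IsBirational.comp`) and `X¹` is regular. [cite: Liu2002, Thm. 8.1.19 (a)] -/
theorem isResolution_comp [IsDomain S] (hπ : IsResolution π)
    (hρ : IsBlowup ρ (vanishingIdeal ⟨closure (sepNodes π), isClosed_closure⟩)) : IsResolution (ρ ≫ π) := by
  haveI : IsIntegral X := hπ.isIntegral_source
  haveI : IsProper ρ := isProper π ρ hρ
  exact ⟨inferInstance, (isBirational π ρ hfin hρ).comp hπ.isBirational, isRegular π ρ hfin hπ.isRegular hρ⟩

/-! ## The node curves: the fibre of the node blow-up over a node -/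

include hfin in
/-- At a node the stalk of the centre's ideal is `𝔪_z` (the node set is a finite set of closed points; tree
`stalkIdeal_vanishingIdeal_of_finite`). [folklore] -/
theorem stalkIdeal_centre_eq_maximalIdeal {z : X} (hz : z ∈ sepNodes π) :
    stalkIdeal (vanishingIdeal (⟨closure (sepNodes π), isClosed_closure⟩ : Closeds X)) z = maximalIdeal (X.presheaf.stalk z) := by
  refine stalkIdeal_vanishingIdeal_of_finite ?_ ?_ ?_
  · rw [coe_centre_eq π hfin]; exact sepNodes_finite π hfin
  · intro x hx
    rw [coe_centre_eq π hfin] at hx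
    exact isClosed_singleton_of_mem_sepNodes π hx
  · change z ∈ ((⟨closure (sepNodes π), isClosed_closure⟩ : Closeds X) : Set X)
    rw [coe_centre_eq π hfin]; exact hz

omit [IsNoetherianRing S] [IsProper π] in
/-- **`𝔪_z ≠ 0` at a node**: a node is a proper specialisation of an exceptional curve, so `𝒪_{X,z}` has positive dimension
(`coheight z ≥ 1`, Mathlib `ringKrullDim_stalk_eq_coheight`) and is not a field. [folklore] -/
theorem maximalIdeal_stalk_ne_bot_of_mem_sepNodes {z : X} (hz : z ∈ sepNodes π) : maximalIdeal (X.presheaf.stalk z) ≠ ⊥ := by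
  -- a curve `η` with `z < η`
  obtain ⟨η, h, hη, hne⟩ : ∃ (η : X) (_ : η ⤳ z), η ∈ excCurvePoints π ∧ z ≠ η := by
    obtain ⟨-, hz'⟩ := (mem_sepNodes_iff π z).mp hz
    rcases hz' with ⟨⟨η, V⟩, -, -, ⟨hη, h, hb⟩, -⟩ | ⟨η, h, V, hb, hη, -⟩
    · exact ⟨η, h, hη, ne_of_isBranchAt h hb⟩
    · exact ⟨η, h, hη, ne_of_isBranchAt h hb⟩
  have hlt : z < η := lt_iff_le_not_ge.mpr ⟨Scheme.le_iff_specializes.mpr h, fun hge =>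
    hne ((Scheme.le_iff_specializes.mp hge).antisymm h).eq⟩
  have hco : (1 : ℕ∞) ≤ Order.coheight z :=
    le_trans (by simp) (Order.coheight_add_one_le hlt)
  intro hbot
  have hF : IsField (X.presheaf.stalk z) := (isField_iff_maximalIdeal_eq).mpr hbot
  have h0 : ringKrullDim (X.presheaf.stalk z) = 0 := ringKrullDim_eq_zero_of_isField hF
  rw [ringKrullDim_stalk_eq_coheight] at h0
  have : Order.coheight z = 0 := by exact_mod_cast h0
  rw [this] at hco
  exact absurd hco (by decide)

include hfin in
/-- **The fibre of the node blow-up over a node is IRREDUCIBLE** (tree `IsBlowup.isIrreducible_preimage_singleton`: the fibre over a point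
`z` with `𝒪_{X,z}` regular of positive dimension and `J_z = 𝔪_z` is a projective space over `κ(z)`). [cite: Hartshorne1977, II Thm. 8.24 (b)] -/
theorem isIrreducible_fibre (hX : Scheme.IsRegular X) (hρ : IsBlowup ρ (vanishingIdeal ⟨closure (sepNodes π), isClosed_closure⟩))
    {z : X} (hz : z ∈ sepNodes π) : IsIrreducible (ρ.base ⁻¹' {z}) := by
  haveI : IsRegularLocalRing (X.presheaf.stalk z) := hX z
  exact hρ.isIrreducible_preimage_singleton z (stalkIdeal_centre_eq_maximalIdeal π hfin hz)
    (maximalIdeal_stalk_ne_bot_of_mem_sepNodes π hz)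

include hfin in
/-- **hnode from «the fibre has two points»**: for the node blow-up `ρ : X¹ → X` of a RESOLUTION `π` of the two-dimensional Noetherian
local domain `S`, over every node `z` whose fibre `ρ⁻¹{z}` has at least two points there is an integral exceptional curve `n` of `ρ ≫ π`
with `ρ⁻¹{z} = closure {n}`: `n` = the generic point of the irreducible closed fibre; it lies over the closed point, has height `≤ 1`
(`IsResolution.height_le_one_of_base_eq_closedPoint` for the resolution `ρ ≫ π`, (1δ)) and height `≥ 1` (a second point of the fibre
is a proper specialisation).  The hypothesis `hpos` («the exceptional fibre over a regular surface point is not a point» — it is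
`ℙ¹_{κ(z)}`) is kept by signature. [cite: Liu2002, Thm. 8.1.19] -/
theorem hnode_of_fibre_nontrivial [IsDomain S] (h2 : ringKrullDim S = 2) (hπ : IsResolution π)
    (hρ : IsBlowup ρ (vanishingIdeal ⟨closure (sepNodes π), isClosed_closure⟩))
    (hpos : ∀ z ∈ sepNodes π, (ρ.base ⁻¹' {z}).Nontrivial) :
    ∀ z ∈ sepNodes π, ∃ n ∈ excCurvePoints (ρ ≫ π), ρ.base ⁻¹' {z} = closure {n} := by
  intro z hz
  have hirr := isIrreducible_fibre π ρ hfin hπ.isRegular hρ hz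
  have hcl : IsClosed (ρ.base ⁻¹' {z}) := (isClosed_singleton_of_mem_sepNodes π hz).preimage ρ.base.hom.continuous
  set n := hirr.genericPoint with hn
  have hfib : ρ.base ⁻¹' {z} = closure {n} := (hirr.closure_genericPoint hcl).symm
  refine ⟨n, ⟨?_, le_antisymm ?_ ?_⟩, hfib⟩
  · -- over the closed point: `ρ n = z`
    have hnz : ρ.base n = z := by
      have : n ∈ ρ.base ⁻¹' {z} := by rw [hfib]; exact subset_closure (Set.mem_singleton n)
      exact this
    change π.base (ρ.base n) = closedPoint S
    rw [hnz]; exact hz.1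
  · -- height `≤ 1`: `ρ ≫ π` is a resolution of the two-dimensional `S`
    refine (isResolution_comp π ρ hfin hπ hρ).height_le_one_of_base_eq_closedPoint h2 ?_
    have hnz : ρ.base n = z := by
      have : n ∈ ρ.base ⁻¹' {z} := by rw [hfib]; exact subset_closure (Set.mem_singleton n)
      exact this
    change π.base (ρ.base n) = closedPoint S
    rw [hnz]; exact hz.1
  · -- height `≥ 1`: a second point of the fibre is a proper specialisation of `n`
    obtain ⟨p, hp, hpn⟩ := (hpos z hz).exists_ne n
    have hsp : n ⤳ p := by
      rw [hfib] at hp; exact specializes_iff_mem_closure.mpr hp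
    have hlt : p < n := lt_iff_le_not_ge.mpr ⟨Scheme.le_iff_specializes.mpr hsp, fun hge =>
      hpn ((Scheme.le_iff_specializes.mp hge).antisymm hsp).eq⟩
    exact le_trans (by simp) (Order.height_add_one_le hlt)

include hfin in
/-- **The subdivision clause for the node blow-up of a resolution**, with `hnode` discharged down to «each fibre over a node has two
points» (`hpos`): every new exceptional curve of `ρ ≫ π` over a node has exactly two neighbours in `incidenceGraph (ρ ≫ π)`, both old —
given `incidenceGraph π` acyclic (UP-6) and every node under two distinct exceptional curves (`𝒩₀`). [cite: Lipman1969, §24 (p. 258)] -/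
theorem subdivision_nodeBlowup_of_fibre_nontrivial [IsDomain S] (h2 : ringKrullDim S = 2) (hπ : IsResolution π)
    (hρ : IsBlowup ρ (vanishingIdeal ⟨closure (sepNodes π), isClosed_closure⟩))
    (hpos : ∀ z ∈ sepNodes π, (ρ.base ⁻¹' {z}).Nontrivial)
    (hG : (incidenceGraph π).IsAcyclic)
    (hsplit : ∀ z ∈ sepNodes π, ∃ a b : X, a ∈ excCurvePoints π ∧ b ∈ excCurvePoints π ∧ a ≠ b ∧ a ⤳ z ∧ b ⤳ z) :
    ∀ n ∈ {n | n ∈ excCurvePoints (ρ ≫ π) ∧ ρ.base n ∈ sepNodes π}, ∃ a b : X1,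
      a ∈ excCurvePoints (ρ ≫ π) \ {n | n ∈ excCurvePoints (ρ ≫ π) ∧ ρ.base n ∈ sepNodes π} ∧
      b ∈ excCurvePoints (ρ ≫ π) \ {n | n ∈ excCurvePoints (ρ ≫ π) ∧ ρ.base n ∈ sepNodes π} ∧ a ≠ b ∧
      (incidenceGraph (ρ ≫ π)).Adj n a ∧ (incidenceGraph (ρ ≫ π)).Adj n b ∧
      ∀ c : X1, (incidenceGraph (ρ ≫ π)).Adj n c → c = a ∨ c = b :=
  subdivision_nodeBlowup_of_isResolution π ρ (hnode_of_fibre_nontrivial π ρ hfin h2 hπ hρ hpos) h2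
    (isResolution_comp π ρ hfin hπ hρ) hfin hρ hG hsplit

/-! ## Discharge of `hpos`: the fibre over a node is a curve (tree `IsBlowup.nontrivial_preimage_singleton`) -/

omit [IsProper π] in
/-- **`dim 𝒪_{X,z} ≥ 2` at a node** of a resolution `π` of the two-dimensional Noetherian local domain `S`: the node `z` lies strictly
below an exceptional curve `η` (`coheight η = 1`, tree `IsResolution.coheight_eq_one_of_mem_excCurvePoints`), so `coheight z ≥ 2`
(Mathlib `ringKrullDim_stalk_eq_coheight`). [folklore] -/
theorem two_le_ringKrullDim_stalk_of_mem_sepNodes [IsDomain S] (h2 : ringKrullDim S = 2) (hπ : IsResolution π) {z : X}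
    (hz : z ∈ sepNodes π) : 2 ≤ ringKrullDim (X.presheaf.stalk z) := by
  -- a curve `η` with `z < η`
  obtain ⟨η, h, hη, hne⟩ : ∃ (η : X) (_ : η ⤳ z), η ∈ excCurvePoints π ∧ z ≠ η := by
    obtain ⟨-, hz'⟩ := (mem_sepNodes_iff π z).mp hz
    rcases hz' with ⟨⟨η, V⟩, -, -, ⟨hη, h, hb⟩, -⟩ | ⟨η, h, V, hb, hη, -⟩
    · exact ⟨η, h, hη, ne_of_isBranchAt h hb⟩
    · exact ⟨η, h, hη, ne_of_isBranchAt h hb⟩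
  have hlt : z < η := lt_iff_le_not_ge.mpr ⟨Scheme.le_iff_specializes.mpr h, fun hge =>
    hne ((Scheme.le_iff_specializes.mp hge).antisymm h).eq⟩
  have hco : Order.coheight η + 1 ≤ Order.coheight z := Order.coheight_add_one_le hlt
  rw [hπ.coheight_eq_one_of_mem_excCurvePoints h2 hη] at hco
  rw [ringKrullDim_stalk_eq_coheight]
  have h21 : (2 : ℕ∞) ≤ Order.coheight z := by simpa [one_add_one_eq_two] using hco
  exact (WithBot.coe_le_coe.mpr h21 : ((2 : ℕ∞) : WithBot ℕ∞) ≤ (Order.coheight z : WithBot ℕ∞))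

include hfin in
/-- **The fibre of the node blow-up over a node has at least two points** — `hpos` DISCHARGED (tree
`IsBlowup.nontrivial_preimage_singleton`: the fibre is an embedded `ℙ¹_{κ(z)}`). [cite: Hartshorne1977, II Thm. 8.24 (b)] -/
theorem fibre_nontrivial [IsDomain S] (h2 : ringKrullDim S = 2) (hπ : IsResolution π)
    (hρ : IsBlowup ρ (vanishingIdeal ⟨closure (sepNodes π), isClosed_closure⟩)) {z : X} (hz : z ∈ sepNodes π) :
    (ρ.base ⁻¹' {z}).Nontrivial := by
  haveI : IsRegularLocalRing (X.presheaf.stalk z) := hπ.isRegular z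
  exact hρ.nontrivial_preimage_singleton z (stalkIdeal_centre_eq_maximalIdeal π hfin hz)
    (two_le_ringKrullDim_stalk_of_mem_sepNodes π h2 hπ hz)

include hfin in
/-- **hnode, UNCONDITIONAL**: for the node blow-up `ρ : X¹ → X` (`IsSepX1Sandwiched` clause) of a RESOLUTION `π` of the two-dimensional
Noetherian local domain `S` with finitely many exceptional curves, over every node `z` there is an integral exceptional curve `n` of
`ρ ≫ π` with `ρ⁻¹{z} = closure {n}` — the input `hnode` of `NodeBlowup.subdivision_nodeBlowup` (p566533). [cite: Liu2002, Thm. 8.1.19] -/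
theorem hnode [IsDomain S] (h2 : ringKrullDim S = 2) (hπ : IsResolution π)
    (hρ : IsBlowup ρ (vanishingIdeal ⟨closure (sepNodes π), isClosed_closure⟩)) :
    ∀ z ∈ sepNodes π, ∃ n ∈ excCurvePoints (ρ ≫ π), ρ.base ⁻¹' {z} = closure {n} :=
  hnode_of_fibre_nontrivial π ρ hfin h2 hπ hρ (fun _ hz => fibre_nontrivial π ρ hfin h2 hπ hρ hz)

include hfin in
/-- **THE SUBDIVISION CLAUSE FOR THE NODE BLOW-UP OF A RESOLUTION, unconditional on blow-up geometry**: for a resolution `π` of the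
two-dimensional Noetherian local domain `S` with finitely many exceptional curves, ACYCLIC incidence graph (UP-6) and every node under two
distinct exceptional curves (`𝒩₀`), and `ρ : X¹ → X` a blow-up of the node set (`IsSepX1Sandwiched`): every new exceptional curve of
`ρ ≫ π` over a node has exactly two neighbours in `incidenceGraph (ρ ≫ π)`, both old. [cite: Lipman1969, §24 (p. 258)] -/
theorem subdivision_nodeBlowup_of_isAcyclic [IsDomain S] (h2 : ringKrullDim S = 2) (hπ : IsResolution π)
    (hρ : IsBlowup ρ (vanishingIdeal ⟨closure (sepNodes π), isClosed_closure⟩))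
    (hG : (incidenceGraph π).IsAcyclic)
    (hsplit : ∀ z ∈ sepNodes π, ∃ a b : X, a ∈ excCurvePoints π ∧ b ∈ excCurvePoints π ∧ a ≠ b ∧ a ⤳ z ∧ b ⤳ z) :
    ∀ n ∈ {n | n ∈ excCurvePoints (ρ ≫ π) ∧ ρ.base n ∈ sepNodes π}, ∃ a b : X1,
      a ∈ excCurvePoints (ρ ≫ π) \ {n | n ∈ excCurvePoints (ρ ≫ π) ∧ ρ.base n ∈ sepNodes π} ∧
      b ∈ excCurvePoints (ρ ≫ π) \ {n | n ∈ excCurvePoints (ρ ≫ π) ∧ ρ.base n ∈ sepNodes π} ∧ a ≠ b ∧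
      (incidenceGraph (ρ ≫ π)).Adj n a ∧ (incidenceGraph (ρ ≫ π)).Adj n b ∧
      ∀ c : X1, (incidenceGraph (ρ ≫ π)).Adj n c → c = a ∨ c = b :=
  subdivision_nodeBlowup_of_fibre_nontrivial π ρ hfin h2 hπ hρ (fun _ hz => fibre_nontrivial π ρ hfin h2 hπ hρ hz) hG hsplit

end Summit.ResolutionOfSingularities.ResolutionOfSingularities.Theorems.NoZeno.ExcCount.NodeBlowup

end
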